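import Literature.Analysis.SegalBargmann.SchwartzMetaplecticGenerators
import Mathlib.Analysis.InnerProductSpace.Calculus
import Mathlib.Analysis.Asymptotics.Lemmas
import Mathlib.Analysis.Calculus.Deriv.Shift
import HarnessLib

/-!
# The chirp group `y ↦ e^{-πi y x·bx}` on `L²(ℝ^σ)`: Lipschitz continuity and strong derivative at Schwartz vectors

For a Schwartz function `f ∈ 𝓢(ℝ^σ)` and a linear map `b`, the one-parameter family of Folland chirps
`y ↦ chirpS (y • b) f` (Folland (4.25), tree file `SchwartzMetaplecticGenerators`), read in `L²` through `toL2`,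

* is Lipschitz: `‖toL2 (chirpS (y • b) f) - toL2 (chirpS (y' • b) f)‖ ≤ ‖toL2 (chirpGen b f)‖ · |y - y'|`;
* has the strong derivative `toL2 (chirpGen b f)` at `y = 0`, where `chirpGen b f (x) = -πi (x·bx) f(x)` is the
  infinitesimal generator applied to `f` (again a Schwartz function), with the explicit second-order remainder
  `‖toL2 (chirpS (y • b) f) - toL2 f - y • toL2 (chirpGen b f)‖ ≤ 2 y² ‖toL2 (chirpArgSq b f)‖`;
* hence every matrix coefficient `y ↦ ⟪toL2 (chirpS (y • b) f), v⟫` is differentiable at `0` with derivative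
  `⟪toL2 (chirpGen b f), v⟫`.

The proofs are elementary: the pointwise bounds `|e^{ia} - 1| ≤ |a|` and `|e^{ia} - 1 - ia| ≤ 2a²` and the
monotonicity of the `L²` norm (`MeasureTheory.Lp.norm_le_mul_norm_of_ae_le_mul`); no dominated convergence is used.
This is the analytic input for differentiating vacuum matrix coefficients of an archimedean Weil datum along an
`SL₂`-circle factorised into chirps (design note `W2inf-zp-design.md` of the theta lane).

References (provenance of the operators only; no statement of print is asserted as a hypothesis):
Folland 1989, *Harmonic Analysis in Phase Space*, Ch. 4 §2 (4.25); Ch. 1 §3 (Schwartz functions as `C^∞`-vectors).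
-/

noncomputable section

open MeasureTheory Complex
open scoped InnerProductSpace

namespace Literature.Analysis.SegalBargmann

/-- `L²(ℝ^σ)` for Lebesgue measure. -/
local notation "L2R" σ:max => (Lp ℂ 2 (volume : Measure (σ → ℝ)))
/-- Folland's Schwartz space `𝓢(ℝ^σ)` on the sup-norm carrier. -/
local notation "SR" σ:max => (SchwartzMap (σ → ℝ) ℂ)

variable {σ : Type*} [Fintype σ] [DecidableEq σ]

/-! ## 1. Two elementary exponential bounds -/

/-- `|e^{ia} - 1| ≤ |a|` for real `a`. [folklore] -/
theorem norm_cexp_ofReal_mul_I_sub_one_le (a : ℝ) : ‖cexp ((a : ℂ) * I) - 1‖ ≤ |a| := by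
  rw [mul_comm]
  have h := Real.norm_exp_I_mul_ofReal_sub_one_le (x := a)
  rwa [Real.norm_eq_abs] at h

/-- `|e^{ia} - 1 - ia| ≤ 2a²` for real `a` (Taylor for `|a| ≤ 1`, triangle inequality for `|a| > 1`). [folklore] -/
theorem norm_cexp_ofReal_mul_I_sub_one_sub_le (a : ℝ) :
    ‖cexp ((a : ℂ) * I) - 1 - (a : ℂ) * I‖ ≤ 2 * a ^ 2 := by
  have ha : ‖(a : ℂ) * I‖ = |a| := by
    rw [norm_mul, Complex.norm_I, mul_one, Complex.norm_real, Real.norm_eq_abs]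
  rcases le_or_gt |a| 1 with h | h
  · calc ‖cexp ((a : ℂ) * I) - 1 - (a : ℂ) * I‖ ≤ ‖(a : ℂ) * I‖ ^ 2 :=
          Complex.norm_exp_sub_one_sub_id_le (by rw [ha]; exact h)
      _ = a ^ 2 := by rw [ha, sq_abs]
      _ ≤ 2 * a ^ 2 := by nlinarith [sq_nonneg a]
  · calc ‖cexp ((a : ℂ) * I) - 1 - (a : ℂ) * I‖ ≤ ‖cexp ((a : ℂ) * I) - 1‖ + ‖(a : ℂ) * I‖ := norm_sub_le _ _
      _ ≤ |a| + |a| := add_le_add (norm_cexp_ofReal_mul_I_sub_one_le a) (le_of_eq ha)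
      _ ≤ 2 * a ^ 2 := by nlinarith [abs_nonneg a, sq_abs a]

/-! ## 2. The generator `-πi x·bx` and the squared exponent as operators on `𝓢` -/

omit [DecidableEq σ] in
/-- Scaling of the exponent: `chirpArg (y • b) x = y · chirpArg b x`. [folklore] -/
theorem chirpArg_smul (y : ℝ) (b : (σ → ℝ) →ₗ[ℝ] (σ → ℝ)) (x : σ → ℝ) :
    chirpArg (y • b) x = y * chirpArg b x := by
  rw [chirpArg, chirpArg, LinearMap.smul_apply, dotProduct_smul, smul_eq_mul]
  ring

/-- The generator multiplier `x ↦ i · chirpArg b x = -πi x·bx` (the `y`-derivative of `e^{-πi y x·bx}` at `0`).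
[cite: Folland1989, (4.25)] -/
def chirpGenMul (b : (σ → ℝ) →ₗ[ℝ] (σ → ℝ)) (x : σ → ℝ) : ℂ := (chirpArg b x : ℂ) * I

omit [DecidableEq σ] in
/-- The real exponent, read in `ℂ`, has temperate growth. [folklore] -/
theorem hasTemperateGrowth_ofReal_chirpArg (b : (σ → ℝ) →ₗ[ℝ] (σ → ℝ)) :
    (fun x : σ → ℝ => (chirpArg b x : ℂ)).HasTemperateGrowth :=
  Complex.ofRealCLM.hasTemperateGrowth.comp (hasTemperateGrowth_chirpArg b)

omit [DecidableEq σ] in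
/-- The generator multiplier has temperate growth. [folklore] -/
theorem hasTemperateGrowth_chirpGenMul (b : (σ → ℝ) →ₗ[ℝ] (σ → ℝ)) : (chirpGenMul b).HasTemperateGrowth :=
  (hasTemperateGrowth_ofReal_chirpArg b).mul (Function.HasTemperateGrowth.const I)

omit [DecidableEq σ] in
/-- The squared exponent, read in `ℂ`, has temperate growth. [folklore] -/
theorem hasTemperateGrowth_ofReal_chirpArg_sq (b : (σ → ℝ) →ₗ[ℝ] (σ → ℝ)) :
    (fun x : σ → ℝ => ((chirpArg b x ^ 2 : ℝ) : ℂ)).HasTemperateGrowth := by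
  have h : (fun x : σ → ℝ => ((chirpArg b x ^ 2 : ℝ) : ℂ))
      = (fun x : σ → ℝ => (chirpArg b x : ℂ)) * fun x : σ → ℝ => (chirpArg b x : ℂ) := by
    funext x
    rw [Pi.mul_apply, sq, Complex.ofReal_mul]
  rw [h]
  exact (hasTemperateGrowth_ofReal_chirpArg b).mul (hasTemperateGrowth_ofReal_chirpArg b)

/-- **The infinitesimal generator of the chirp group on `𝓢`**: `chirpGen b f (x) = -πi (x·bx) f(x)`.
[cite: Folland1989, (4.25)] -/
def chirpGen (b : (σ → ℝ) →ₗ[ℝ] (σ → ℝ)) : (SR σ) →L[ℂ] SR σ := SchwartzMap.smulLeftCLM ℂ (chirpGenMul b)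

omit [DecidableEq σ] in
/-- Pointwise formula for the generator. [cite: Folland1989, (4.25)] -/
@[simp] theorem chirpGen_apply (b : (σ → ℝ) →ₗ[ℝ] (σ → ℝ)) (f : SR σ) (x : σ → ℝ) :
    chirpGen b f x = (chirpArg b x : ℂ) * I * f x := by
  rw [chirpGen, SchwartzMap.smulLeftCLM_apply_apply (hasTemperateGrowth_chirpGenMul b), smul_eq_mul, chirpGenMul]

/-- Multiplication by the squared exponent `(πx·bx)²` on `𝓢` (controls the second-order remainder). [folklore] -/
def chirpArgSq (b : (σ → ℝ) →ₗ[ℝ] (σ → ℝ)) : (SR σ) →L[ℂ] SR σ :=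
  SchwartzMap.smulLeftCLM ℂ fun x : σ → ℝ => ((chirpArg b x ^ 2 : ℝ) : ℂ)

omit [DecidableEq σ] in
/-- Pointwise formula. [folklore] -/
@[simp] theorem chirpArgSq_apply (b : (σ → ℝ) →ₗ[ℝ] (σ → ℝ)) (f : SR σ) (x : σ → ℝ) :
    chirpArgSq b f x = ((chirpArg b x ^ 2 : ℝ) : ℂ) * f x := by
  rw [chirpArgSq, SchwartzMap.smulLeftCLM_apply_apply (hasTemperateGrowth_ofReal_chirpArg_sq b), smul_eq_mul]

/-! ## 3. Pointwise first- and second-order bounds -/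

omit [DecidableEq σ] in
/-- `|e^{-πi y x·bx} f(x) - f(x)| ≤ |y| · |chirpGen b f (x)|`. [folklore] -/
theorem norm_chirpS_sub_le (b : (σ → ℝ) →ₗ[ℝ] (σ → ℝ)) (y : ℝ) (f : SR σ) (x : σ → ℝ) :
    ‖chirpS (y • b) f x - f x‖ ≤ |y| * ‖chirpGen b f x‖ := by
  have h1 : chirpS (y • b) f x - f x = (cexp (((y * chirpArg b x : ℝ) : ℂ) * I) - 1) * f x := by
    rw [chirpS_apply, chirpMul, chirpArg_smul, sub_one_mul]
  rw [h1, norm_mul, chirpGen_apply, norm_mul, norm_mul, Complex.norm_I, mul_one, Complex.norm_real,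
    Real.norm_eq_abs]
  have h := norm_cexp_ofReal_mul_I_sub_one_le (y * chirpArg b x)
  rw [abs_mul] at h
  calc ‖cexp (((y * chirpArg b x : ℝ) : ℂ) * I) - 1‖ * ‖f x‖ ≤ |y| * |chirpArg b x| * ‖f x‖ :=
        mul_le_mul_of_nonneg_right h (norm_nonneg _)
    _ = |y| * (|chirpArg b x| * ‖f x‖) := by ring

omit [DecidableEq σ] in
/-- `|e^{-πi y x·bx} f(x) - f(x) - y · chirpGen b f (x)| ≤ 2 y² |chirpArgSq b f (x)|`. [folklore] -/
theorem norm_chirpS_sub_sub_le (b : (σ → ℝ) →ₗ[ℝ] (σ → ℝ)) (y : ℝ) (f : SR σ) (x : σ → ℝ) :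
    ‖chirpS (y • b) f x - f x - (y : ℂ) * chirpGen b f x‖ ≤ 2 * y ^ 2 * ‖chirpArgSq b f x‖ := by
  have h1 : chirpS (y • b) f x - f x - (y : ℂ) * chirpGen b f x
      = (cexp (((y * chirpArg b x : ℝ) : ℂ) * I) - 1 - ((y * chirpArg b x : ℝ) : ℂ) * I) * f x := by
    rw [chirpS_apply, chirpGen_apply, chirpMul, chirpArg_smul, Complex.ofReal_mul]
    ring
  rw [h1, norm_mul, chirpArgSq_apply, norm_mul, Complex.norm_real, Real.norm_eq_abs, abs_of_nonneg (sq_nonneg _)]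
  have h := norm_cexp_ofReal_mul_I_sub_one_sub_le (y * chirpArg b x)
  calc ‖cexp (((y * chirpArg b x : ℝ) : ℂ) * I) - 1 - ((y * chirpArg b x : ℝ) : ℂ) * I‖ * ‖f x‖
        ≤ 2 * (y * chirpArg b x) ^ 2 * ‖f x‖ := mul_le_mul_of_nonneg_right h (norm_nonneg _)
    _ = 2 * y ^ 2 * (chirpArg b x ^ 2 * ‖f x‖) := by ring

/-! ## 4. `L²` bounds by monotonicity of the norm -/

omit [DecidableEq σ] in
/-- A pointwise domination of Schwartz functions gives the same domination of their `L²` norms. [folklore] -/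
theorem norm_toL2_le_mul_norm_toL2 {g h : SR σ} {C : ℝ} (hC : ∀ x, ‖g x‖ ≤ C * ‖h x‖) :
    ‖toL2 g‖ ≤ C * ‖toL2 h‖ := by
  refine Lp.norm_le_mul_norm_of_ae_le_mul ?_
  filter_upwards [coeFn_toL2 g, coeFn_toL2 h] with x hg hh
  rw [hg, hh]
  exact hC x

omit [DecidableEq σ] in
/-- **First-order bound**: `‖e^{-πi y x·bx} f - f‖_{L²} ≤ |y| ‖chirpGen b f‖_{L²}`. [folklore] -/
theorem norm_toL2_chirpS_sub_le (b : (σ → ℝ) →ₗ[ℝ] (σ → ℝ)) (y : ℝ) (f : SR σ) :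
    ‖toL2 (chirpS (y • b) f) - toL2 f‖ ≤ |y| * ‖toL2 (chirpGen b f)‖ := by
  rw [← map_sub]
  exact norm_toL2_le_mul_norm_toL2 fun x => by
    rw [sub_apply]
    exact norm_chirpS_sub_le b y f x

omit [DecidableEq σ] in
/-- **Second-order bound**: `‖e^{-πi y x·bx} f - f - y · chirpGen b f‖_{L²} ≤ 2y² ‖chirpArgSq b f‖_{L²}`. [folklore] -/
theorem norm_toL2_chirpS_sub_sub_le (b : (σ → ℝ) →ₗ[ℝ] (σ → ℝ)) (y : ℝ) (f : SR σ) :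
    ‖toL2 (chirpS (y • b) f) - toL2 f - y • toL2 (chirpGen b f)‖ ≤ 2 * y ^ 2 * ‖toL2 (chirpArgSq b f)‖ := by
  rw [← ContinuousLinearMap.map_smul_of_tower, ← map_sub, ← map_sub]
  exact norm_toL2_le_mul_norm_toL2 fun x => by
    rw [sub_apply, sub_apply, smul_apply, Complex.real_smul]
    exact norm_chirpS_sub_sub_le b y f x

/-! ## 5. Group law in `L²`, Lipschitz continuity, strong derivative -/

omit [DecidableEq σ] in
/-- The group law moves the base point: `chirpS (y • b) f = chirpS (y' • b) (chirpS ((y - y') • b) f)`. [folklore] -/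
theorem chirpS_smul_eq_comp_sub (b : (σ → ℝ) →ₗ[ℝ] (σ → ℝ)) (y y' : ℝ) (f : SR σ) :
    chirpS (y • b) f = chirpS (y' • b) (chirpS ((y - y') • b) f) := by
  rw [← ContinuousLinearMap.comp_apply, ← chirpS_smul_add, add_sub_cancel]

omit [DecidableEq σ] in
/-- **Lipschitz bound**: `‖e^{-πi y x·bx} f - e^{-πi y' x·bx} f‖_{L²} ≤ ‖chirpGen b f‖_{L²} |y - y'|` (the chirp at
`y'` is unitary on `L²`). [folklore] -/
theorem dist_toL2_chirpS_le (b : (σ → ℝ) →ₗ[ℝ] (σ → ℝ)) (f : SR σ) (y y' : ℝ) :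
    dist (toL2 (chirpS (y • b) f)) (toL2 (chirpS (y' • b) f)) ≤ ‖toL2 (chirpGen b f)‖ * dist y y' := by
  rw [dist_eq_norm, Real.dist_eq]
  have h : toL2 (chirpS (y • b) f) - toL2 (chirpS (y' • b) f)
      = chirpL2 (y' • b) (toL2 (chirpS ((y - y') • b) f) - toL2 f) := by
    rw [map_sub, ← toL2_chirpS, ← toL2_chirpS, ← chirpS_smul_eq_comp_sub]
  rw [h, LinearIsometryEquiv.norm_map, mul_comm]
  exact norm_toL2_chirpS_sub_le b (y - y') f

omit [DecidableEq σ] in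
/-- The chirp orbit of a Schwartz vector is Lipschitz in `L²`. [folklore] -/
theorem lipschitzWith_toL2_chirpS (b : (σ → ℝ) →ₗ[ℝ] (σ → ℝ)) (f : SR σ) :
    LipschitzWith ‖toL2 (chirpGen b f)‖₊ fun y : ℝ => toL2 (chirpS (y • b) f) :=
  LipschitzWith.of_dist_le_mul fun y y' => by
    rw [coe_nnnorm]
    exact dist_toL2_chirpS_le b f y y'

omit [DecidableEq σ] in
/-- **Strong continuity** of `y ↦ e^{-πi y x·bx} f` in `L²` at a Schwartz vector. [folklore] -/
theorem continuous_toL2_chirpS (b : (σ → ℝ) →ₗ[ℝ] (σ → ℝ)) (f : SR σ) :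
    Continuous fun y : ℝ => toL2 (chirpS (y • b) f) :=
  (lipschitzWith_toL2_chirpS b f).continuous

omit [DecidableEq σ] in
/-- **Strong derivative at `0`**: `d/dy|₀ e^{-πi y x·bx} f = chirpGen b f` in `L²(ℝ^σ)` for Schwartz `f`
(`𝓢` consists of `C¹`-vectors of the chirp group). [folklore] -/
theorem hasDerivAt_toL2_chirpS_zero (b : (σ → ℝ) →ₗ[ℝ] (σ → ℝ)) (f : SR σ) :
    HasDerivAt (fun y : ℝ => toL2 (chirpS (y • b) f)) (toL2 (chirpGen b f)) 0 := by
  rw [hasDerivAt_iff_isLittleO]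
  have h0 : toL2 (chirpS ((0 : ℝ) • b) f) = toL2 f := by
    rw [zero_smul, chirpS_zero, ContinuousLinearMap.id_apply]
  simp only [sub_zero, h0]
  refine Asymptotics.IsBigO.trans_isLittleO ?_ (Asymptotics.isLittleO_pow_id (n := 2) one_lt_two)
  refine Asymptotics.IsBigO.of_bound (2 * ‖toL2 (chirpArgSq b f)‖) (Filter.Eventually.of_forall fun y => ?_)
  rw [Real.norm_eq_abs, abs_of_nonneg (sq_nonneg y)]
  calc ‖toL2 (chirpS (y • b) f) - toL2 f - y • toL2 (chirpGen b f)‖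
        ≤ 2 * y ^ 2 * ‖toL2 (chirpArgSq b f)‖ := norm_toL2_chirpS_sub_sub_le b y f
    _ = 2 * ‖toL2 (chirpArgSq b f)‖ * y ^ 2 := by ring

omit [DecidableEq σ] in
/-- **Strong derivative at any base point**: `d/dy|_{y₀} e^{-πi y x·bx} f = e^{-πi y₀ x·bx} · chirpGen b f` in `L²`.
[folklore] -/
theorem hasDerivAt_toL2_chirpS (b : (σ → ℝ) →ₗ[ℝ] (σ → ℝ)) (f : SR σ) (y₀ : ℝ) :
    HasDerivAt (fun y : ℝ => toL2 (chirpS (y • b) f)) (toL2 (chirpS (y₀ • b) (chirpGen b f))) y₀ := by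
  have h1 : (fun y : ℝ => toL2 (chirpS (y • b) f))
      = fun y : ℝ => (chirpL2 (y₀ • b) : (L2R σ) →L[ℂ] L2R σ) (toL2 (chirpS ((y - y₀) • b) f)) := by
    funext y
    rw [chirpS_smul_eq_comp_sub b y y₀ f, toL2_chirpS]
    rfl
  rw [h1, toL2_chirpS]
  have h2 : HasDerivAt (fun y : ℝ => toL2 (chirpS ((y - y₀) • b) f)) (toL2 (chirpGen b f)) y₀ := by
    have h : HasDerivAt (fun y : ℝ => toL2 (chirpS (y • b) f)) (toL2 (chirpGen b f)) (y₀ - y₀) := by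
      rw [sub_self]
      exact hasDerivAt_toL2_chirpS_zero b f
    exact h.comp_sub_const y₀ y₀
  exact ((chirpL2 (y₀ • b) : (L2R σ) →L[ℂ] L2R σ).restrictScalars ℝ).hasFDerivAt.comp_hasDerivAt y₀ h2

/-! ## 6. Matrix coefficients -/

omit [DecidableEq σ] in
/-- **Derivative of matrix coefficients**: `d/dy|₀ ⟪e^{-πi y x·bx} f, v⟫ = ⟪chirpGen b f, v⟫` for Schwartz `f` and any
`v ∈ L²`. [folklore] -/
theorem hasDerivAt_inner_toL2_chirpS_zero (b : (σ → ℝ) →ₗ[ℝ] (σ → ℝ)) (f : SR σ) (v : L2R σ) :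
    HasDerivAt (fun y : ℝ => ⟪toL2 (chirpS (y • b) f), v⟫_ℂ) ⟪toL2 (chirpGen b f), v⟫_ℂ 0 := by
  have h := (hasDerivAt_toL2_chirpS_zero b f).inner ℂ (hasDerivAt_const (0 : ℝ) v)
  simpa only [inner_zero_right, zero_add] using h

omit [DecidableEq σ] in
/-- The conjugate-side coefficient: `d/dy|₀ ⟪v, e^{-πi y x·bx} f⟫ = ⟪v, chirpGen b f⟫`. [folklore] -/
theorem hasDerivAt_inner_toL2_chirpS_zero' (b : (σ → ℝ) →ₗ[ℝ] (σ → ℝ)) (f : SR σ) (v : L2R σ) :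
    HasDerivAt (fun y : ℝ => ⟪v, toL2 (chirpS (y • b) f)⟫_ℂ) ⟪v, toL2 (chirpGen b f)⟫_ℂ 0 := by
  have h := (hasDerivAt_const (0 : ℝ) v).inner ℂ (hasDerivAt_toL2_chirpS_zero b f)
  simpa only [inner_zero_left, add_zero] using h

omit [DecidableEq σ] in
/-- **The diagonal coefficient at a Schwartz vector**: `d/dy|₀ ⟪e^{-πi y x·bx} f, f⟫ = ⟪chirpGen b f, f⟫ =
`-πi ∫ (x·bx) |f|²` — the quantity that carries the zero-point weight. [folklore] -/
theorem hasDerivAt_inner_toL2_chirpS_self (b : (σ → ℝ) →ₗ[ℝ] (σ → ℝ)) (f : SR σ) :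
    HasDerivAt (fun y : ℝ => ⟪toL2 (chirpS (y • b) f), toL2 f⟫_ℂ) ⟪toL2 (chirpGen b f), toL2 f⟫_ℂ 0 :=
  hasDerivAt_inner_toL2_chirpS_zero b f (toL2 f)

end Literature.Analysis.SegalBargmann
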